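import Literature.MathematicalPhysics.QuantumFieldTheory.Balaban1983to89.B8Prop6CubeMemberScalarBdryBeta
import Literature.MathematicalPhysics.QuantumFieldTheory.Balaban1983to89.B8Thm32GBoundCubeMember

/-!
# `Balaban1983to89.B8Prop6CubeMemberScalarBdryBetaOfGBound` — [Balaban1985RegularSpaces] PROPOSITION 6 (p. 99) AT A CUBE OF PRINT'S BIG-BLOCK
# SUB-LATTICE FROM THE TWO SCALAR FLAT β CLAUSES AND THE 𝒢-BOUND ([Balaban1985BackgroundPropagators] THEOREM 3.2) — the flat p6 letter's three REAL
# families DISCHARGED BY NAME (dag-n05-c F8 ∕ F10)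

statement-level skeleton of published theorems with citation tags; proofs where landed; nothing here is a claim about the
Yang–Mills mass gap

PDF held: `paper:balaban1985-cmp99-regular-spaces-gauge-fixing`; read first-hand this session: p. 98 [PDF 24] (the cubes `□`, `□_j` of Prop. 6: «□ … is a union
of cubes of the size R₁M₁Lʲη, where R₁, M₁ are smallest integers for which all the theorems of the papers [2, 4] are valid … M is a multiple of R₁M₁ … a distance
between boundaries of these cubes is equal to R₁M₁Lʲη … for every j the cube □_j is a sum of the big blocks of the lattice T_{L^{−j}}»), p. 99 [PDF 25] (Prop. 6).
[4] = `[Balaban1985BackgroundPropagators]` Thms 3.1–3.3 pp. 397–399.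

CITATION HEADER (lean-in-tree rule).  Cell `pub-ymgap` (HUMAN RULING D-0062, Track A), DAG node N05 = [B8], seat `pub-ymgap-dag-n05-e` g9 (R141 (C) row s3b — the
flat line's p6 letter, consumer side).  WHY: the flat p6 letter of record `B8Prop6CubeMemberScalarBdryBeta.gaugedBoundB8_cubeMember_scalar_bdryβ` (p557429, this
seat g8) has as hypotheses, per cube, the two SCALAR flat (1.59) β clauses and THREE REAL inequality families (REAL-1 = (1.101), REAL-2 = (1.92) + Δ-entry, REAL-3 =
(1.98)) on the explicit flat Dirichlet matrices `T = η⁻²Δ_D + QᵀwQ`, `Q`; dag-n05-c's (R1′) programme (g8 + g9, 22 files) proved REAL-1 and REAL-1′ and reduced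
REAL-2 ∧ REAL-3 to ONE operator estimate, so that `B8Prop6CubeMemberRealOfGBound.prop6_real123_of_gbound_printed` (F8, p554361) gives all three families at the printed
weights `wPrinted` from the 𝒢-BOUND `wt(j_p)⁴L^{−dj_p}|((QT⁻²Qᵀ)⁻¹X)_p| ≤ C_𝒢·sup|X|` ([4] Thm 3.2 (3.48) at `U = 1`, row-summed), named `B8Thm32GBoundCubeMember.
GBoundCubeMemberPrinted` (F10, p555349) — ON PRINT'S BIG-BLOCK SUB-LATTICE of cube data (`M_hL ∣ ρ`, `M_hL ∣ M`, `R·M_hL ≤ ρ`, `2L ≤ R`, thresholds `M₀ ≤ L·M_h`,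
`N₀ + 1 ≤ R·L·M_h`, `ρ₀ ≤ ρ`), i.e. exactly print's p. 98 side conditions with `(R₁, M₁) ↔ (R, M_h)` above the thresholds «for which all the theorems of [2, 4] are
valid».  dag-n05-c asked this seat to consume it (bus I.22120 «your p6 letter's real hypotheses collapse to hG», I.22204).  THIS FILE does so, PER CUBE: NODE 00's
carrier `Node00.CubeB8` (L ≤ ρ ≤ M, 11d < M, L ≤ dM) is more permissive than print's p. 98 (no divisibility, no threshold on `ρ`), so the family-level sentence
`B8.Prop6Printed d L B₁ c₁ (zdCub ∘ f)` ranges over cubes print never treats and cannot be fed from print-faithful per-cube estimates; the honest composition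
displays print's side conditions as hypotheses on the cube datum `c` (LOCATED-CARRIER, bus line of this seat g9; repair options recorded there).

WHAT THIS FILE PROVES (theorems only, no `def`; kind «kernel-checked proof»).
* ★ `gaugedBoundB8_cubeMember_scalar_bdryβ_of_gboundAt` — for `d, L ≥ 2`, `B₀ > 0` with `2 ≤ 5dLB₀`, `0 ≤ B_∂` with `4B_∂ ≤ (dL − 1)B₀`, and ANY `C_𝒢 ≥ 0`:
  `∃ c₁ > 0` and thresholds `ρ₀, M₀, N₀` such that at every cube `c : CubeB8 d L K Ω` ON THE SUB-LATTICE above threshold (witnesses `M_h ≥ 3`, `R ≥ 2L` displayed),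
  the SCALAR four-line β clause at `c.k` + `U₀ ∈ 𝔄_K({Ω_j}, α₀)` unitary + `7dL²Mα₀ ≤ c₁` + THE 𝒢-BOUND DISPLAYED at the cube's data (every truncation `1 ≤ n ≤ k`,
  weights `wPrinted (d−1) (L−1) η`, constant `C_𝒢`) + the SCALAR two-line β clause at every truncation ⟹ `Node00.GaugedBoundB8 L η U₀ c (7dL²·(5dLB₀)·Mα₀)`
  — (1.135)–(1.138) of Proposition 6 at that cube.  The three REAL binders of p557429 are discharged by F8 at `w := wPrinted`; nothing else changes.
* ★ `gaugedBoundB8_cubeMember_scalar_bdryβ_of_GBound (hG : GBoundCubeMemberPrinted (d − 1) (L − 1))` — the same with the estimate NAMED (F10): hypotheses per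
  cube = the two scalar β clauses only.  CONDITIONAL on the open named fact (the gate records a conditional result); `GBoundCubeMemberPrinted` is dag-n05-c's
  successor programme (`HOME/pub-ymgap-dag-n05-c/R23-DESIGN.md`), NOT this seat's target and not restated here.

HONEST SCOPE.  Compositions by name; nothing of [4] is proved here: the two scalar β clauses ([4] Thm 3.3 at `U = 1` for `G(1)`, `H(1)` on the finite cube with
exterior data, a-priori form, β reading; A6-PARTIAL exactly as declared in p557429: FALSE below an absolute threshold in `B₀`, kernel threshold `B₀ ≥ d + 1` located
by ref-E g10 READ-12) and the 𝒢-bound ([4] Thm 3.2) are HYPOTHESES; REAL-1 ∕ REAL-1′ behind F8 are dag-n05-c's kernel theorems.  The side conditions are print's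
(p. 98), displayed, not hidden; no claim at cubes off the sub-lattice or below threshold.  Count-neutral; N05 NOT discharged; one finite `𝕋⁴` programme at fixed `ε`,
Bałaban as printed; nothing continuum ∕ ℝ⁴ ∕ OS ∕ mass-gap ∕ Clay.  No `sorry`, no `def`, no `instance`, no `notation`.  Unit `pub-ymgap-dag-n05-e` (g9), 2026-08-27.

RELATED IN THE TREE, NOT DUPLICATED: `B8Prop6CubeMemberScalarBdryBeta.gaugedBoundB8_cubeMember_scalar_bdryβ` ∕ `prop6Printed_zdCub_scalar_bdryβ` (USED ∕ the
family-level letter with the REAL binders displayed), `B8Prop6CubeMemberRealOfGBound.prop6_real123_of_gbound_printed` (USED), `B8Thm32GBoundCubeMember.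
GBoundCubeMemberPrinted` ∕ `prop6_real123_printed_of_GBound` (USED), `B8Eq1101CubeMemberWeights.wPrinted(_facts)` (USED), `Node00.CarriersB8Cube` (the carrier).
-/

noncomputable section

open NormedSpace

namespace Literature.MathematicalPhysics.QuantumFieldTheory.Balaban1983to89.B8Prop6CubeMemberScalarBdryBetaOfGBound

open scoped Matrix
open MatrixLog B7Prop1Explicit B7Prop2Explicit B7Prop1Local B7Eq92Concrete
open B7Prop4GeneralLevels (logCovIter linCovIter)
open B8Ineq132 (covDerivFwd InAk BondTouches)
open B8Eq140Level (SideTouches)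
open B8Eq143PlaqExpansion (pdiv)
open B8Eq146AExpansion (iEta plaqCovDeriv)
open B8Eq155JBound (Jcur wsup)
open B8ScaledSupNorm (bondNorm msup)
open B8Eq138LandauZd (IsLandau138 covLap)
open B8LambdaSpaceKLevel (wt)
open B8Eq131CubesAdmissible (cubeFam)
open B8CubeMemberZd (cubeLamS cubeLamB)
open B9SupplySockB9P3ZdBeta (CrossB)
open B8Eq1101CubeMemberWeights (wPrinted wPrinted_facts)
open B8Prop6CubeMemberRealOfGBound (prop6_real123_of_gbound_printed)
open B8Thm32GBoundCubeMember (GBoundCubeMemberPrinted prop6_real123_printed_of_GBound)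
open B8Prop6CubeMemberScalarBdryBeta (gaugedBoundB8_cubeMember_scalar_bdryβ)
open Node00 (CubeB8 GaugedBoundB8)
open Literature.MathematicalPhysics.QuantumLattice (blockMap)

export B7Prop1Explicit (Site)

variable {d : ℕ}

variable {𝔸 : Type} [CStarAlgebra 𝔸] [Nontrivial 𝔸]

/-! ## §1 Proposition 6 at a sub-lattice cube from the scalar β clauses + the 𝒢-bound displayed at the cube's data -/

open Classical in
/-- ★ **PROPOSITION 6 (p. 99), (1.135)–(1.138) AS `Node00.GaugedBoundB8` AT A CUBE OF PRINT'S BIG-BLOCK SUB-LATTICE, FROM THE TWO SCALAR FLAT β CLAUSES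
AND THE 𝒢-BOUND DISPLAYED AT THE CUBE'S DATA** — p557429's `gaugedBoundB8_cubeMember_scalar_bdryβ` with its weights instantiated at dag-n05-c's printed
weights `wPrinted (d−1) (L−1) η` and its three REAL inequality families DISCHARGED by dag-n05-c's `prop6_real123_of_gbound_printed` (F8: REAL-1 ∕ REAL-1′ kernel
theorems + algebra) from the 𝒢-bound `wt(j_p)⁴·L^{−dj_p}·|((QT⁻¹T⁻¹Qᵀ)⁻¹X)_p| ≤ C_𝒢·sup|X|` ([4] Theorem 3.2 (3.48) at `U = 1`, row-summed) at every truncation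
`1 ≤ n ≤ k` of that cube; print's p. 98 side conditions on the cube datum («M is a multiple of R₁M₁ … □_j a sum of the big blocks», `(R₁, M₁) ↔ (R, M_h)` above
the thresholds `ρ₀, M₀, N₀` «for which all the theorems of [2, 4] are valid») displayed as hypotheses.  Any `C_𝒢 ≥ 0`; `c₁` depends on it.
[cite: Balaban1985RegularSpaces, Prop. 6 (1.135)–(1.138) p.99, p.98, Thm 4 p.88, Prop. 3 p.87, (1.59) p.86, (1.31) p.82, (1.91)–(1.92) p.91, (1.98) p.92, (1.101) p.93; Balaban1985BackgroundPropagators, Thm 3.2 (3.48) p.398, Thm 3.1 (3.47) p.398, Thm 3.3 p.399] -/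
theorem gaugedBoundB8_cubeMember_scalar_bdryβ_of_gboundAt (hd2 : 2 ≤ d) {L : ℕ} (hL : 2 ≤ L) {B₀ Bbd CG : ℝ} (hB₀ : 0 < B₀)
    (hB : 2 ≤ 5 * (d : ℝ) * L * B₀) (hBbd : 0 ≤ Bbd) (hBd : 4 * Bbd ≤ ((d : ℝ) * L - 1) * B₀) (hCG : 0 ≤ CG) :
    ∃ c₁ ρ₀ M₀ : ℝ, ∃ N₀ : ℕ, 0 < c₁ ∧ ∀ (η : ℝ), 0 < η → ∀ {K : ℕ} {Ω : ℕ → Set (Site d)} (c : CubeB8 d L K Ω),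
      -- PRINT'S SIDE CONDITIONS (p. 98) on the cube datum, above threshold: big blocks `M_hL`, `ρ ≥ R·M_hL`, `M_hL ∣ ρ`, `M_hL ∣ M`
      ∀ (Mh R : ℕ), 3 ≤ Mh → M₀ ≤ (L : ℝ) * Mh → Mh * L ∣ c.ρ → Mh * L ∣ c.M → R * (Mh * L) ≤ c.ρ → 2 * L ≤ R →
        N₀ + 1 ≤ R * (L * Mh) → ρ₀ ≤ (c.ρ : ℝ) →
      -- THE SCALAR FLAT FOUR-LINE (1.59) CLAUSE OF PROPOSITION 3's FRAME at the cube's top truncation `c.k`: ℂ-valued bond functions in the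
      -- flat Landau gauge on the collars of `{□_j}`, exterior-collar allowance on each line ([4] Thm 3.3 at `U = 1` for `G(1)`, `H(1)`, a priori)
      (∀ φ : Site d → Fin d → ℂ,
        IsLandau138 L c.k η (cubeFam false L c.a c.M c.ρ c.k 0) (cubeLamS L c.a c.M c.ρ c.k c.k) (1 : Site d → Fin d → ℂˣ) φ →
        (∀ (y : Site d) (τ : Fin d), (∀ j, j ≤ c.k → ¬ SideTouches (cubeFam false L c.a c.M c.ρ c.k j) y τ) → φ y τ = 0) →
        msup L c.k η (-(1 : ℝ)) (fun j (b : Site d × Fin d) => SideTouches (cubeFam false L c.a c.M c.ρ c.k j) b.1 b.2) (fun b => φ b.1 b.2)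
          ≤ B₀ * (bondNorm L c.k η (-(3 : ℝ)) (cubeFam false L c.a c.M c.ρ c.k) (fun x μ => Jcur η (1 : Site d → Fin d → ℂˣ) φ μ x)
            + wsup 1 (fun p : {p : ℕ × (Site d × Fin d) // p.1 ≤ c.k ∧ (p.2 ∈ cubeLamB L c.a c.M c.ρ c.k c.k p.1 ∨ (p.1 = 0 ∧ CrossB ((cubeFam false L c.a c.M c.ρ c.k) 0) p.2))} =>
                linCovIter L (1 : Site d → Fin d → ℂˣ) (iEta η φ) p.1.1 p.1.2.1 p.1.2.2))
            + Bbd * msup L c.k η (-(1 : ℝ)) (fun j (b : Site d × Fin d) => j = 0 ∧ SideTouches (cubeFam false L c.a c.M c.ρ c.k 0) b.1 b.2 ∧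
                ¬ BondTouches (cubeFam false L c.a c.M c.ρ c.k 0) b.1 b.2) (fun b => φ b.1 b.2) ∧
        msup L c.k η (-(2 : ℝ)) (fun j (t : Fin d × Fin d × Site d) => SideTouches (cubeFam false L c.a c.M c.ρ c.k j) t.2.2 t.2.1)
            (fun t => covDerivFwd η (1 : Site d → Fin d → ℂˣ) t.1 (fun z => φ z t.2.1) t.2.2)
          ≤ B₀ * (bondNorm L c.k η (-(3 : ℝ)) (cubeFam false L c.a c.M c.ρ c.k) (fun x μ => Jcur η (1 : Site d → Fin d → ℂˣ) φ μ x)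
            + wsup 1 (fun p : {p : ℕ × (Site d × Fin d) // p.1 ≤ c.k ∧ (p.2 ∈ cubeLamB L c.a c.M c.ρ c.k c.k p.1 ∨ (p.1 = 0 ∧ CrossB ((cubeFam false L c.a c.M c.ρ c.k) 0) p.2))} =>
                linCovIter L (1 : Site d → Fin d → ℂˣ) (iEta η φ) p.1.1 p.1.2.1 p.1.2.2))
            + Bbd * msup L c.k η (-(1 : ℝ)) (fun j (b : Site d × Fin d) => j = 0 ∧ SideTouches (cubeFam false L c.a c.M c.ρ c.k 0) b.1 b.2 ∧
                ¬ BondTouches (cubeFam false L c.a c.M c.ρ c.k 0) b.1 b.2) (fun b => φ b.1 b.2) ∧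
        bondNorm L c.k η (-(3 : ℝ)) (cubeFam false L c.a c.M c.ρ c.k) (fun x μ => pdiv η (1 : Site d → Fin d → ℂˣ) (plaqCovDeriv η (1 : Site d → Fin d → ℂˣ) φ) μ x)
          ≤ B₀ * (bondNorm L c.k η (-(3 : ℝ)) (cubeFam false L c.a c.M c.ρ c.k) (fun x μ => Jcur η (1 : Site d → Fin d → ℂˣ) φ μ x)
            + wsup 1 (fun p : {p : ℕ × (Site d × Fin d) // p.1 ≤ c.k ∧ (p.2 ∈ cubeLamB L c.a c.M c.ρ c.k c.k p.1 ∨ (p.1 = 0 ∧ CrossB ((cubeFam false L c.a c.M c.ρ c.k) 0) p.2))} =>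
                linCovIter L (1 : Site d → Fin d → ℂˣ) (iEta η φ) p.1.1 p.1.2.1 p.1.2.2))
            + Bbd * msup L c.k η (-(1 : ℝ)) (fun j (b : Site d × Fin d) => j = 0 ∧ SideTouches (cubeFam false L c.a c.M c.ρ c.k 0) b.1 b.2 ∧
                ¬ BondTouches (cubeFam false L c.a c.M c.ρ c.k 0) b.1 b.2) (fun b => φ b.1 b.2) ∧
        bondNorm L c.k η (-(3 : ℝ)) (cubeFam false L c.a c.M c.ρ c.k) (fun x μ => covLap η (1 : Site d → Fin d → ℂˣ) (fun z => φ z μ) x)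
          ≤ B₀ * (bondNorm L c.k η (-(3 : ℝ)) (cubeFam false L c.a c.M c.ρ c.k) (fun x μ => Jcur η (1 : Site d → Fin d → ℂˣ) φ μ x)
            + wsup 1 (fun p : {p : ℕ × (Site d × Fin d) // p.1 ≤ c.k ∧ (p.2 ∈ cubeLamB L c.a c.M c.ρ c.k c.k p.1 ∨ (p.1 = 0 ∧ CrossB ((cubeFam false L c.a c.M c.ρ c.k) 0) p.2))} =>
                linCovIter L (1 : Site d → Fin d → ℂˣ) (iEta η φ) p.1.1 p.1.2.1 p.1.2.2))
            + Bbd * msup L c.k η (-(1 : ℝ)) (fun j (b : Site d × Fin d) => j = 0 ∧ SideTouches (cubeFam false L c.a c.M c.ρ c.k 0) b.1 b.2 ∧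
                ¬ BondTouches (cubeFam false L c.a c.M c.ρ c.k 0) b.1 b.2) (fun b => φ b.1 b.2)) →
      ∀ (U₀ : Site d → Fin d → 𝔸ˣ), (∀ x κ, U₀ x κ ∈ unitaryUnits 𝔸) → ∀ (α₀ : ℝ), 0 < α₀ → InAk L K η α₀ Ω U₀ →
      7 * d * (L : ℝ) ^ 2 * c.M * α₀ ≤ c₁ →
      -- THE 𝒢-BOUND ([4] Theorem 3.2 (3.48), row-summed) DISPLAYED at this cube's data: every truncation `1 ≤ n ≤ k`, weights `wPrinted`, constant `C_𝒢`
      (∀ n, 1 ≤ n → n ≤ c.k → ∀ (S : Finset (Site d)), (∀ x, x ∈ S ↔ x ∈ cubeFam false L c.a c.M c.ρ c.k 0) →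
        ∀ (B : Finset (ℕ × Site d)), (∀ p, p ∈ B ↔ p.1 ≤ n ∧ p.2 ∈ cubeLamS L c.a c.M c.ρ c.k n p.1) →
        ∀ (K : Site d → Site d → ℝ), (∀ x z, K x z =
          ((η ^ 2)⁻¹ * ∑ μ : Fin d, ((2 : ℝ) * (if z = x then (1 : ℝ) else 0) - (if z = x + e μ then (1 : ℝ) else 0)
            - (if z = x - e μ then (1 : ℝ) else 0))) +
          (∑ j ∈ Finset.range (n + 1), (if blockMap (L ^ j) x ∈ cubeLamS L c.a c.M c.ρ c.k n j ∧ blockMap (L ^ j) z = blockMap (L ^ j) x then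
            wPrinted (d - 1) (L - 1) η j * ((((L : ℝ) ^ d)⁻¹) ^ j) ^ 2 else 0))) →
        ∀ (T : Matrix ↥S ↥S ℝ), T = Matrix.of (fun x z : ↥S => K x.1 z.1) →
        ∀ (Q : Matrix ↥B ↥S ℝ), Q = Matrix.of (fun (p : ↥B) (z : ↥S) =>
          if blockMap (L ^ p.1.1) z.1 = p.1.2 then (((L : ℝ) ^ d)⁻¹) ^ p.1.1 else 0) →
        ∀ (X : ↥B → ℝ) (s : ℝ), 0 ≤ s → (∀ p', |X p'| ≤ s) → ∀ p : ↥B,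
          wt L η p.1.1 ^ 4 * ((((L : ℝ)) ^ d) ^ p.1.1)⁻¹ * |∑ p' : ↥B, (Q * T⁻¹ * T⁻¹ * Qᵀ)⁻¹ p p' * X p'| ≤ CG * s) →
      -- THE SCALAR FLAT TWO-LINE (1.59) CLAUSE OF THEOREM 4's FRAME at every truncation `m ≤ c.k` (ℂ-valued, flat Landau gauge, collar allowance)
      (∀ m, 1 ≤ m → m ≤ c.k → ∀ φ : Site d → Fin d → ℂ,
        IsLandau138 L m η ((cubeFam false L c.a c.M c.ρ c.k) 0) ((cubeLamS L c.a c.M c.ρ c.k) m) (1 : Site d → Fin d → ℂˣ) φ →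
        (∀ (y : Site d) (τ : Fin d), (∀ j, j ≤ m → ¬ SideTouches ((cubeFam false L c.a c.M c.ρ c.k) j) y τ) → φ y τ = 0) →
        msup L m η (-(1 : ℝ)) (fun j (b : Site d × Fin d) => SideTouches ((cubeFam false L c.a c.M c.ρ c.k) j) b.1 b.2) (fun b => φ b.1 b.2)
          ≤ B₀ * (bondNorm L m η (-(3 : ℝ)) (cubeFam false L c.a c.M c.ρ c.k) (fun x μ => Jcur η (1 : Site d → Fin d → ℂˣ) φ μ x)
            + wsup 1 (fun p : {p : ℕ × (Site d × Fin d) // p.1 ≤ m ∧ (p.2 ∈ (cubeLamB L c.a c.M c.ρ c.k) m p.1 ∨ (p.1 = 0 ∧ CrossB ((cubeFam false L c.a c.M c.ρ c.k) 0) p.2))} =>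
                linCovIter L (1 : Site d → Fin d → ℂˣ) (iEta η φ) p.1.1 p.1.2.1 p.1.2.2))
            + Bbd * msup L m η (-(1 : ℝ)) (fun j (b : Site d × Fin d) => j = 0 ∧ SideTouches ((cubeFam false L c.a c.M c.ρ c.k) 0) b.1 b.2 ∧
                ¬ BondTouches ((cubeFam false L c.a c.M c.ρ c.k) 0) b.1 b.2) (fun b => φ b.1 b.2) ∧
        msup L m η (-(2 : ℝ)) (fun j (t : Fin d × Fin d × Site d) => SideTouches ((cubeFam false L c.a c.M c.ρ c.k) j) t.2.2 t.2.1)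
            (fun t => covDerivFwd η (1 : Site d → Fin d → ℂˣ) t.1 (fun z => φ z t.2.1) t.2.2)
          ≤ B₀ * (bondNorm L m η (-(3 : ℝ)) (cubeFam false L c.a c.M c.ρ c.k) (fun x μ => Jcur η (1 : Site d → Fin d → ℂˣ) φ μ x)
            + wsup 1 (fun p : {p : ℕ × (Site d × Fin d) // p.1 ≤ m ∧ (p.2 ∈ (cubeLamB L c.a c.M c.ρ c.k) m p.1 ∨ (p.1 = 0 ∧ CrossB ((cubeFam false L c.a c.M c.ρ c.k) 0) p.2))} =>
                linCovIter L (1 : Site d → Fin d → ℂˣ) (iEta η φ) p.1.1 p.1.2.1 p.1.2.2))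
            + Bbd * msup L m η (-(1 : ℝ)) (fun j (b : Site d × Fin d) => j = 0 ∧ SideTouches ((cubeFam false L c.a c.M c.ρ c.k) 0) b.1 b.2 ∧
                ¬ BondTouches ((cubeFam false L c.a c.M c.ρ c.k) 0) b.1 b.2) (fun b => φ b.1 b.2)) →
      GaugedBoundB8 L η U₀ c (7 * d * (L : ℝ) ^ 2 * (5 * (d : ℝ) * L * B₀) * c.M * α₀) := by
  -- write `d = d' + 1`, `L = ℓ + 1` (dag-n05-c's convention)
  obtain ⟨d', rfl⟩ : ∃ d', d = d' + 1 := ⟨d - 1, by omega⟩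
  obtain ⟨ℓ, rfl⟩ : ∃ ℓ, L = ℓ + 1 := ⟨L - 1, by omega⟩
  have hℓ : 1 ≤ ℓ := by omega
  -- dag-n05-c's F8: the three REAL families from the 𝒢-bound, constants depending on `d, ℓ` (and `C_𝒢`)
  obtain ⟨BG, BG', ρ₀, M₀, N₀, hBG, hBG', -, -, F8⟩ := prop6_real123_of_gbound_printed d' ℓ hℓ
  have hB₀'H : 0 < BG * (BG' * CG) + BG := by positivity
  have hB₂' : 0 ≤ BG' * CG + 8 := by positivity
  have hBR : 0 ≤ 1 + ((BG' * CG + 8) + 8) * BG := by positivity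
  have hfree : 3 * (2 * ((d' + 1 : ℕ) : ℝ) * (((ℓ + 1 : ℕ) : ℝ)) ^ 2) * BG * (1 + ((BG' * CG + 8) + 8) * BG) ≤
      3 * (2 * ((d' + 1 : ℕ) : ℝ) * (((ℓ + 1 : ℕ) : ℝ)) ^ 2) * BG * (1 + ((BG' * CG + 8) + 8) * BG) + 1 := by linarith
  have hB₀' : 0 < 3 * (2 * ((d' + 1 : ℕ) : ℝ) * (((ℓ + 1 : ℕ) : ℝ)) ^ 2) * BG * (1 + ((BG' * CG + 8) + 8) * BG) + 1 := by positivity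
  have hC₂ : 2097152 * (((d' + 1 : ℕ) : ℝ) + 1) ^ 2 ≤ 2097152 * (((d' + 1 : ℕ) : ℝ) + 1) ^ 2 := le_rfl
  -- p557429's per-cube letter with these constants
  obtain ⟨c₁, hc₁, G⟩ := gaugedBoundB8_cubeMember_scalar_bdryβ (𝔸 := 𝔸) hd2 hL hB₀ hB₀' hB hC₂ hB₀'H hB₂' hBG.le hBR hfree hBbd hBd
  refine ⟨c₁, ρ₀, M₀, N₀, hc₁, ?_⟩
  intro η hη K Ω c Mh R hMh hM0 hρd hMd hR hR2 hRN hρ0 SC4 U₀ hU₀ α₀ hα hAK hs GB SC2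
  refine G η hη c SC4 U₀ hU₀ α₀ hα hAK hs (wPrinted d' ℓ η) (fun j => ((wPrinted_facts d' hℓ hη).1 j).le) ?_ SC2
  -- the REAL block of p557429 at `w := wPrinted`, from F8 at this cube datum and truncation
  intro n hn hnk S hS B hB K hK T hT Q hQ
  have hρpos : 0 < c.ρ := lt_of_lt_of_le (by omega) c.L_le_ρ
  have hM0' : M₀ ≤ ((ℓ : ℝ) + 1) * Mh := by
    have : ((ℓ + 1 : ℕ) : ℝ) = (ℓ : ℝ) + 1 := by push_cast; ring
    rw [← this]; exact hM0
  obtain ⟨h1, h2, h3⟩ := F8 η hη Mh hMh hM0' c.a c.M c.ρ c.k n R hn hnk hρd hMd hρpos hR hR2 hRN hρ0 S hS B hB K hK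
    T hT Q hQ CG hCG (GB n hn hnk S hS B hB K hK T hT Q hQ)
  refine ⟨h1, fun X s hs hXs φ hφ0 hφS => ?_, h3⟩
  obtain ⟨hf, hg, hΔ⟩ := h2 X s hs hXs φ hφ0 hφS
  have hmono : BG * (BG' * CG) * s ≤ (BG * (BG' * CG) + BG) * s := by nlinarith
  exact ⟨fun x => (hf x).trans hmono, fun j hj p hp => (hg j hj p hp).trans hmono, hΔ⟩

#print axioms gaugedBoundB8_cubeMember_scalar_bdryβ_of_gboundAt

/-! ## §2 The same with the 𝒢-bound NAMED: `GBoundCubeMemberPrinted (d − 1) (L − 1)` -/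

open Classical in
/-- ★ **PROPOSITION 6 AT A CUBE OF PRINT'S BIG-BLOCK SUB-LATTICE FROM THE TWO SCALAR FLAT β CLAUSES, CONDITIONAL ON THE NAMED 𝒢-BOUND**
`GBoundCubeMemberPrinted (d − 1) (L − 1)` ([4] Theorem 3.2 (3.48) at `U = 1` on the cube member, dag-n05-c F10; OPEN in the tree): the flat p6 letter whose only
per-cube hypotheses are the SCALAR four-line β clause at the top truncation and the SCALAR two-line β clause at every truncation — the three REAL families of
p557429 discharged by name.  Side conditions of p. 98 displayed; thresholds merged with the named fact's.  CONDITIONAL (the gate records it).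
[cite: Balaban1985RegularSpaces, Prop. 6 (1.135)–(1.138) p.99, p.98, Thm 4 p.88, Prop. 3 p.87, (1.59) p.86, (1.31) p.82; Balaban1985BackgroundPropagators, Thm 3.2 (3.48) p.398, Thm 3.3 p.399] -/
theorem gaugedBoundB8_cubeMember_scalar_bdryβ_of_GBound (hd2 : 2 ≤ d) {L : ℕ} (hL : 2 ≤ L) {B₀ Bbd : ℝ} (hB₀ : 0 < B₀)
    (hB : 2 ≤ 5 * (d : ℝ) * L * B₀) (hBbd : 0 ≤ Bbd) (hBd : 4 * Bbd ≤ ((d : ℝ) * L - 1) * B₀)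
    (hG : GBoundCubeMemberPrinted (d - 1) (L - 1)) :
    ∃ c₁ ρ₀ M₀ : ℝ, ∃ N₀ : ℕ, 0 < c₁ ∧ ∀ (η : ℝ), 0 < η → ∀ {K : ℕ} {Ω : ℕ → Set (Site d)} (c : CubeB8 d L K Ω),
      -- PRINT'S SIDE CONDITIONS (p. 98) on the cube datum, above threshold
      ∀ (Mh R : ℕ), 3 ≤ Mh → M₀ ≤ (L : ℝ) * Mh → Mh * L ∣ c.ρ → Mh * L ∣ c.M → R * (Mh * L) ≤ c.ρ → 2 * L ≤ R →
        N₀ + 1 ≤ R * (L * Mh) → ρ₀ ≤ (c.ρ : ℝ) →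
      -- THE SCALAR FLAT FOUR-LINE (1.59) CLAUSE OF PROPOSITION 3's FRAME at the cube's top truncation `c.k`: ℂ-valued bond functions in the
      -- flat Landau gauge on the collars of `{□_j}`, exterior-collar allowance on each line ([4] Thm 3.3 at `U = 1` for `G(1)`, `H(1)`, a priori)
      (∀ φ : Site d → Fin d → ℂ,
        IsLandau138 L c.k η (cubeFam false L c.a c.M c.ρ c.k 0) (cubeLamS L c.a c.M c.ρ c.k c.k) (1 : Site d → Fin d → ℂˣ) φ →
        (∀ (y : Site d) (τ : Fin d), (∀ j, j ≤ c.k → ¬ SideTouches (cubeFam false L c.a c.M c.ρ c.k j) y τ) → φ y τ = 0) →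
        msup L c.k η (-(1 : ℝ)) (fun j (b : Site d × Fin d) => SideTouches (cubeFam false L c.a c.M c.ρ c.k j) b.1 b.2) (fun b => φ b.1 b.2)
          ≤ B₀ * (bondNorm L c.k η (-(3 : ℝ)) (cubeFam false L c.a c.M c.ρ c.k) (fun x μ => Jcur η (1 : Site d → Fin d → ℂˣ) φ μ x)
            + wsup 1 (fun p : {p : ℕ × (Site d × Fin d) // p.1 ≤ c.k ∧ (p.2 ∈ cubeLamB L c.a c.M c.ρ c.k c.k p.1 ∨ (p.1 = 0 ∧ CrossB ((cubeFam false L c.a c.M c.ρ c.k) 0) p.2))} =>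
                linCovIter L (1 : Site d → Fin d → ℂˣ) (iEta η φ) p.1.1 p.1.2.1 p.1.2.2))
            + Bbd * msup L c.k η (-(1 : ℝ)) (fun j (b : Site d × Fin d) => j = 0 ∧ SideTouches (cubeFam false L c.a c.M c.ρ c.k 0) b.1 b.2 ∧
                ¬ BondTouches (cubeFam false L c.a c.M c.ρ c.k 0) b.1 b.2) (fun b => φ b.1 b.2) ∧
        msup L c.k η (-(2 : ℝ)) (fun j (t : Fin d × Fin d × Site d) => SideTouches (cubeFam false L c.a c.M c.ρ c.k j) t.2.2 t.2.1)
            (fun t => covDerivFwd η (1 : Site d → Fin d → ℂˣ) t.1 (fun z => φ z t.2.1) t.2.2)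
          ≤ B₀ * (bondNorm L c.k η (-(3 : ℝ)) (cubeFam false L c.a c.M c.ρ c.k) (fun x μ => Jcur η (1 : Site d → Fin d → ℂˣ) φ μ x)
            + wsup 1 (fun p : {p : ℕ × (Site d × Fin d) // p.1 ≤ c.k ∧ (p.2 ∈ cubeLamB L c.a c.M c.ρ c.k c.k p.1 ∨ (p.1 = 0 ∧ CrossB ((cubeFam false L c.a c.M c.ρ c.k) 0) p.2))} =>
                linCovIter L (1 : Site d → Fin d → ℂˣ) (iEta η φ) p.1.1 p.1.2.1 p.1.2.2))
            + Bbd * msup L c.k η (-(1 : ℝ)) (fun j (b : Site d × Fin d) => j = 0 ∧ SideTouches (cubeFam false L c.a c.M c.ρ c.k 0) b.1 b.2 ∧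
                ¬ BondTouches (cubeFam false L c.a c.M c.ρ c.k 0) b.1 b.2) (fun b => φ b.1 b.2) ∧
        bondNorm L c.k η (-(3 : ℝ)) (cubeFam false L c.a c.M c.ρ c.k) (fun x μ => pdiv η (1 : Site d → Fin d → ℂˣ) (plaqCovDeriv η (1 : Site d → Fin d → ℂˣ) φ) μ x)
          ≤ B₀ * (bondNorm L c.k η (-(3 : ℝ)) (cubeFam false L c.a c.M c.ρ c.k) (fun x μ => Jcur η (1 : Site d → Fin d → ℂˣ) φ μ x)
            + wsup 1 (fun p : {p : ℕ × (Site d × Fin d) // p.1 ≤ c.k ∧ (p.2 ∈ cubeLamB L c.a c.M c.ρ c.k c.k p.1 ∨ (p.1 = 0 ∧ CrossB ((cubeFam false L c.a c.M c.ρ c.k) 0) p.2))} =>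
                linCovIter L (1 : Site d → Fin d → ℂˣ) (iEta η φ) p.1.1 p.1.2.1 p.1.2.2))
            + Bbd * msup L c.k η (-(1 : ℝ)) (fun j (b : Site d × Fin d) => j = 0 ∧ SideTouches (cubeFam false L c.a c.M c.ρ c.k 0) b.1 b.2 ∧
                ¬ BondTouches (cubeFam false L c.a c.M c.ρ c.k 0) b.1 b.2) (fun b => φ b.1 b.2) ∧
        bondNorm L c.k η (-(3 : ℝ)) (cubeFam false L c.a c.M c.ρ c.k) (fun x μ => covLap η (1 : Site d → Fin d → ℂˣ) (fun z => φ z μ) x)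
          ≤ B₀ * (bondNorm L c.k η (-(3 : ℝ)) (cubeFam false L c.a c.M c.ρ c.k) (fun x μ => Jcur η (1 : Site d → Fin d → ℂˣ) φ μ x)
            + wsup 1 (fun p : {p : ℕ × (Site d × Fin d) // p.1 ≤ c.k ∧ (p.2 ∈ cubeLamB L c.a c.M c.ρ c.k c.k p.1 ∨ (p.1 = 0 ∧ CrossB ((cubeFam false L c.a c.M c.ρ c.k) 0) p.2))} =>
                linCovIter L (1 : Site d → Fin d → ℂˣ) (iEta η φ) p.1.1 p.1.2.1 p.1.2.2))
            + Bbd * msup L c.k η (-(1 : ℝ)) (fun j (b : Site d × Fin d) => j = 0 ∧ SideTouches (cubeFam false L c.a c.M c.ρ c.k 0) b.1 b.2 ∧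
                ¬ BondTouches (cubeFam false L c.a c.M c.ρ c.k 0) b.1 b.2) (fun b => φ b.1 b.2)) →
      ∀ (U₀ : Site d → Fin d → 𝔸ˣ), (∀ x κ, U₀ x κ ∈ unitaryUnits 𝔸) → ∀ (α₀ : ℝ), 0 < α₀ → InAk L K η α₀ Ω U₀ →
      7 * d * (L : ℝ) ^ 2 * c.M * α₀ ≤ c₁ →
      -- THE SCALAR FLAT TWO-LINE (1.59) CLAUSE OF THEOREM 4's FRAME at every truncation `m ≤ c.k` (ℂ-valued, flat Landau gauge, collar allowance)
      (∀ m, 1 ≤ m → m ≤ c.k → ∀ φ : Site d → Fin d → ℂ,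
        IsLandau138 L m η ((cubeFam false L c.a c.M c.ρ c.k) 0) ((cubeLamS L c.a c.M c.ρ c.k) m) (1 : Site d → Fin d → ℂˣ) φ →
        (∀ (y : Site d) (τ : Fin d), (∀ j, j ≤ m → ¬ SideTouches ((cubeFam false L c.a c.M c.ρ c.k) j) y τ) → φ y τ = 0) →
        msup L m η (-(1 : ℝ)) (fun j (b : Site d × Fin d) => SideTouches ((cubeFam false L c.a c.M c.ρ c.k) j) b.1 b.2) (fun b => φ b.1 b.2)
          ≤ B₀ * (bondNorm L m η (-(3 : ℝ)) (cubeFam false L c.a c.M c.ρ c.k) (fun x μ => Jcur η (1 : Site d → Fin d → ℂˣ) φ μ x)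
            + wsup 1 (fun p : {p : ℕ × (Site d × Fin d) // p.1 ≤ m ∧ (p.2 ∈ (cubeLamB L c.a c.M c.ρ c.k) m p.1 ∨ (p.1 = 0 ∧ CrossB ((cubeFam false L c.a c.M c.ρ c.k) 0) p.2))} =>
                linCovIter L (1 : Site d → Fin d → ℂˣ) (iEta η φ) p.1.1 p.1.2.1 p.1.2.2))
            + Bbd * msup L m η (-(1 : ℝ)) (fun j (b : Site d × Fin d) => j = 0 ∧ SideTouches ((cubeFam false L c.a c.M c.ρ c.k) 0) b.1 b.2 ∧
                ¬ BondTouches ((cubeFam false L c.a c.M c.ρ c.k) 0) b.1 b.2) (fun b => φ b.1 b.2) ∧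
        msup L m η (-(2 : ℝ)) (fun j (t : Fin d × Fin d × Site d) => SideTouches ((cubeFam false L c.a c.M c.ρ c.k) j) t.2.2 t.2.1)
            (fun t => covDerivFwd η (1 : Site d → Fin d → ℂˣ) t.1 (fun z => φ z t.2.1) t.2.2)
          ≤ B₀ * (bondNorm L m η (-(3 : ℝ)) (cubeFam false L c.a c.M c.ρ c.k) (fun x μ => Jcur η (1 : Site d → Fin d → ℂˣ) φ μ x)
            + wsup 1 (fun p : {p : ℕ × (Site d × Fin d) // p.1 ≤ m ∧ (p.2 ∈ (cubeLamB L c.a c.M c.ρ c.k) m p.1 ∨ (p.1 = 0 ∧ CrossB ((cubeFam false L c.a c.M c.ρ c.k) 0) p.2))} =>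
                linCovIter L (1 : Site d → Fin d → ℂˣ) (iEta η φ) p.1.1 p.1.2.1 p.1.2.2))
            + Bbd * msup L m η (-(1 : ℝ)) (fun j (b : Site d × Fin d) => j = 0 ∧ SideTouches ((cubeFam false L c.a c.M c.ρ c.k) 0) b.1 b.2 ∧
                ¬ BondTouches ((cubeFam false L c.a c.M c.ρ c.k) 0) b.1 b.2) (fun b => φ b.1 b.2)) →
      GaugedBoundB8 L η U₀ c (7 * d * (L : ℝ) ^ 2 * (5 * (d : ℝ) * L * B₀) * c.M * α₀) := by
  -- unpack the named fact at `(d − 1, L − 1) = (d', ℓ)`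
  obtain ⟨d', rfl⟩ : ∃ d', d = d' + 1 := ⟨d - 1, by omega⟩
  obtain ⟨ℓ, rfl⟩ : ∃ ℓ, L = ℓ + 1 := ⟨L - 1, by omega⟩
  obtain ⟨CG, ρG, MG, NG, hCG, hGb⟩ := hG
  obtain ⟨c₁, ρ₀, M₀, N₀, hc₁, H⟩ :=
    gaugedBoundB8_cubeMember_scalar_bdryβ_of_gboundAt (𝔸 := 𝔸) hd2 hL hB₀ hB hBbd hBd hCG
  refine ⟨c₁, max ρ₀ ρG, max M₀ MG, max N₀ NG, hc₁, ?_⟩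
  intro η hη K Ω c Mh R hMh hM0 hρd hMd hR hR2 hRN hρ0 SC4 U₀ hU₀ α₀ hα hAK hs SC2
  have hM01 : M₀ ≤ ((ℓ + 1 : ℕ) : ℝ) * Mh := (le_max_left _ _).trans hM0
  have hM02 : MG ≤ ((ℓ : ℝ) + 1) * Mh := by
    have : ((ℓ + 1 : ℕ) : ℝ) = (ℓ : ℝ) + 1 := by push_cast; ring
    rw [← this]; exact (le_max_right _ _).trans hM0
  have hRN1 : N₀ + 1 ≤ R * ((ℓ + 1) * Mh) := le_trans (Nat.add_le_add_right (le_max_left _ _) 1) hRN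
  have hRN2 : NG + 1 ≤ R * ((ℓ + 1) * Mh) := le_trans (Nat.add_le_add_right (le_max_right _ _) 1) hRN
  have hρ1 : ρ₀ ≤ (c.ρ : ℝ) := (le_max_left _ _).trans hρ0
  have hρ2 : ρG ≤ (c.ρ : ℝ) := (le_max_right _ _).trans hρ0
  have hρpos : 0 < c.ρ := lt_of_lt_of_le (by omega) c.L_le_ρ
  refine H η hη c Mh R hMh hM01 hρd hMd hR hR2 hRN1 hρ1 SC4 U₀ hU₀ α₀ hα hAK hs ?_ SC2
  -- the displayed 𝒢-bound at this cube from the named fact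
  intro n hn hnk S hS B hB K hK T hT Q hQ X s hs hXs p
  exact hGb η hη Mh hMh hM02 c.a c.M c.ρ c.k n R hn hnk hρd hMd hρpos hR hR2 hRN2 hρ2 S hS B hB K hK T hT Q hQ X s hs hXs p

#print axioms gaugedBoundB8_cubeMember_scalar_bdryβ_of_GBound

end Literature.MathematicalPhysics.QuantumFieldTheory.Balaban1983to89.B8Prop6CubeMemberScalarBdryBetaOfGBound

end

/-! ## HONEST SCOPE — VACUOUS AS TYPED (2026-08-27, seat `pub-ymgap-dag-n05-e` g9; director-ym LINE №196, dag-lead DEDUP-349∕350)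

Every theorem of this file whose hypotheses contain a (1.59)-type clause or socket in EDITION β at a CUBE MEMBER of (1.131) — the SCALAR clauses
SC2∕SC4, the 𝔸-valued sockets `SockB9P3D4β` ∕ `H59Dβ` ∕ the four-line Prop.-3-frame socket, or a hypothesis SET that yields them (`B9.Thm33Printed` +
dag-n06-b's member-local binders at every truncation) — is VACUOUS AS TYPED: the averaging datum is read over `B8CubeMemberZd.cubeLamB`, whose condition 1
«fine box ⊂ □_j» EMPTIES print's crossing bonds of (1.31) at levels `j ≥ 1`, and the interior SHELL GAUGE MODES `∂(𝟙λ)`, `λ ⊂ □_j`, then defeat the clause at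
every cube member with `k ≥ 1` for ALL constants `B₀, B_∂` — KERNEL CERTIFICATE dag-n05-c `B8Ineq159FlatShellModeVacuity` (p572834:
`not_flat159β_two_cubeMember(_one)`, `sc2_uninhabited_cubeB8`; ref-E g12 READ-11 A6-FINAL), `Ω₀ = ℤᵈ` twin `…ShellModeVacuityUniv` (p576185).  The theorems
stay TRUE and PASS-AS-DECLARED; their content at cube members is nil.  Nothing of [Balaban1985RegularSpaces] is refuted: print's class ([B6] (2.3), «at least
one end-point in Ω_j^{(j)}») contains the crossing bonds and kills the modes (dag-n05-c `B8Ineq159FlatShellModeCrossingDatum`).  SUPERSEDED BY EDITION γ: the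
datum class of record becomes dag-n05-c's `B8Ineq159FlatCubeMemberPrinted.cubeLamBP` (p573921∕p575549), the socket dag-n06-b's `B9SupplySockB9P3ZdGamma`, the
Theorem-4 driver this seat's `B8Eq142KLevelLocalGamma` ∕ `B8Thm4KLevelGamma`; this file is kept as history and for its class-independent mechanics
(composition shape, ⊗-id transfer, the level-0 crossing MOVE), re-run by token swap in γ.  Count-neutral; N05 NOT discharged; nothing continuum ∕ ℝ⁴ ∕ OS ∕
mass-gap ∕ Clay. -/
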